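import Mathlib

/-!
# SoloBlind — truncated Neumann (Picard) iteration with a certified remainder (ENGINE P, PLAN §121.17)

ENGINE P needs the vector `y = N u`, `N = (1 - E)⁻¹`, as a Taylor model.  It computes the Picard
iterates `y₀ = b`, `y_{k+1} = b + E y_k` in Taylor-model arithmetic and stops after `n` steps; the
tail is a ball.  With positive weights `w`, a weighted Schur bound `∑ j ‖E m j‖ w j ≤ θ w m`, `θ < 1`,
and `‖b j‖ ≤ B w j`, any fixed point `y = b + E y` satisfies

* `iterate_error` : `‖y m - (iter b E n) m‖ ≤ θ^(n+1) · B/(1-θ) · w m` for every `n`.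

(`fixedPoint_bound'` re-derives the a-priori bound `‖y m‖ ≤ B/(1-θ) w m` so that the file is
self-contained, Mathlib only.)
-/

namespace Summit.AnomalousDissipation.SoloBlind.NeumannIterate

open Finset Matrix

variable {n : ℕ} {E : Matrix (Fin n) (Fin n) ℂ} {w : Fin n → ℝ} {θ : ℝ}

/-- Picard iterates: `iter b E 0 = b`, `iter b E (k+1) = b + E (iter b E k)`. -/
def iter (b : Fin n → ℂ) (E : Matrix (Fin n) (Fin n) ℂ) : ℕ → (Fin n → ℂ)
  | 0 => b
  | k + 1 => b + E *ᵥ iter b E k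

/-- Weighted Schur test maps the envelope `C · w` to `θ C · w`. -/
theorem schur_mulVec_le (hrow : ∀ m, ∑ j, ‖E m j‖ * w j ≤ θ * w m)
    {v : Fin n → ℂ} {C : ℝ} (hC : 0 ≤ C) (hv : ∀ j, ‖v j‖ ≤ C * w j) (m : Fin n) :
    ‖(E *ᵥ v) m‖ ≤ θ * C * w m := by
  calc ‖(E *ᵥ v) m‖ = ‖∑ j, E m j * v j‖ := rfl
    _ ≤ ∑ j, ‖E m j * v j‖ := norm_sum_le _ _
    _ ≤ ∑ j, ‖E m j‖ * (C * w j) := by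
        refine sum_le_sum fun j _ => ?_
        rw [norm_mul]; exact mul_le_mul_of_nonneg_left (hv j) (norm_nonneg _)
    _ = C * ∑ j, ‖E m j‖ * w j := by rw [mul_sum]; exact sum_congr rfl fun j _ => by ring
    _ ≤ C * (θ * w m) := mul_le_mul_of_nonneg_left (hrow m) hC
    _ = θ * C * w m := by ring

/-- A priori bound for fixed points `y = b + E y` (weighted maximum argument). -/
theorem fixedPoint_bound' (hw : ∀ m, 0 < w m) (hθ : θ < 1)
    (hrow : ∀ m, ∑ j, ‖E m j‖ * w j ≤ θ * w m) {y b : Fin n → ℂ} (hy : y = b + E *ᵥ y)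
    {B : ℝ} (hb : ∀ j, ‖b j‖ ≤ B * w j) : ∀ m, ‖y m‖ ≤ B / (1 - θ) * w m := by
  rcases Nat.eq_zero_or_pos n with hn | hn
  · subst hn; exact fun m => m.elim0
  -- weighted maximiser
  have hne : (univ : Finset (Fin n)).Nonempty := ⟨⟨0, hn⟩, mem_univ _⟩
  obtain ⟨m₀, -, hmax⟩ := exists_max_image univ (fun m => ‖y m‖ / w m) hne
  set C := ‖y m₀‖ / w m₀ with hC
  have hC0 : 0 ≤ C := div_nonneg (norm_nonneg _) (hw m₀).le
  have henv : ∀ j, ‖y j‖ ≤ C * w j := fun j => by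
    have := (div_le_iff₀ (hw j)).mp (hmax j (mem_univ j)); linarith
  have hEy : ∀ m, ‖(E *ᵥ y) m‖ ≤ θ * C * w m := schur_mulVec_le hrow hC0 henv
  have hkey : C * w m₀ ≤ B * w m₀ + θ * C * w m₀ := by
    have h1 : ‖y m₀‖ = C * w m₀ := by rw [hC, div_mul_cancel₀ _ (hw m₀).ne']
    have h2 : ‖y m₀‖ ≤ ‖b m₀‖ + ‖(E *ᵥ y) m₀‖ := by
      conv_lhs => rw [hy]
      exact norm_add_le _ _
    linarith [hb m₀, hEy m₀]
  have hCle : C ≤ B / (1 - θ) := by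
    rw [le_div_iff₀ (by linarith)]; nlinarith [hw m₀]
  exact fun m => (henv m).trans (mul_le_mul_of_nonneg_right hCle (hw m).le)

/-- Error of the `n`-th Picard iterate: `‖y m - (iter b E n) m‖ ≤ θ^(n+1) B/(1-θ) w m`. -/
theorem iterate_error (hw : ∀ m, 0 < w m) (hθ : θ < 1)
    (hrow : ∀ m, ∑ j, ‖E m j‖ * w j ≤ θ * w m) {y b : Fin n → ℂ} (hy : y = b + E *ᵥ y)
    {B : ℝ} (hb : ∀ j, ‖b j‖ ≤ B * w j) :
    ∀ k m, ‖y m - iter b E k m‖ ≤ θ ^ (k + 1) * (B / (1 - θ)) * w m := by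
  rcases Nat.eq_zero_or_pos n with hn | hn
  · subst hn; exact fun k m => m.elim0
  have hB : ∀ m, ‖y m‖ ≤ B / (1 - θ) * w m := fixedPoint_bound' hw hθ hrow hy hb
  have m₁ : Fin n := ⟨0, hn⟩
  have hθ0 : 0 ≤ θ := by
    have h0 : 0 ≤ ∑ j, ‖E m₁ j‖ * w j := sum_nonneg fun j _ => mul_nonneg (norm_nonneg _) (hw j).le
    nlinarith [hrow m₁, hw m₁]
  have hBdiv : 0 ≤ B / (1 - θ) := by
    by_contra hneg
    push Not at hneg
    have h1 := hB m₁
    have h2 : B / (1 - θ) * w m₁ < 0 := mul_neg_of_neg_of_pos hneg (hw m₁)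
    linarith [norm_nonneg (y m₁)]
  intro k
  induction k with
  | zero =>
      intro m
      -- y - b = E y
      have h1 : y m - iter b E 0 m = (E *ᵥ y) m := by
        have := congrArg (fun f => f m) hy
        simp only [Pi.add_apply] at this
        simp only [iter]; rw [this]; ring
      rw [h1]
      have := schur_mulVec_le hrow hBdiv hB m
      simpa [pow_one, mul_assoc] using this
  | succ k ih =>
      intro m
      -- y - iter (k+1) = E (y - iter k)
      have h1 : y m - iter b E (k + 1) m = (E *ᵥ (y - iter b E k)) m := by
        have := congrArg (fun f => f m) hy
        simp only [Pi.add_apply] at this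
        simp only [iter, Pi.add_apply, mulVec_sub, Pi.sub_apply]
        rw [this]; ring
      rw [h1]
      have hC : 0 ≤ θ ^ (k + 1) * (B / (1 - θ)) := mul_nonneg (pow_nonneg hθ0 _) hBdiv
      have := schur_mulVec_le hrow hC (fun j => by simpa [Pi.sub_apply] using ih j) m
      calc ‖(E *ᵥ (y - iter b E k)) m‖ ≤ θ * (θ ^ (k + 1) * (B / (1 - θ))) * w m := this
        _ = θ ^ (k + 1 + 1) * (B / (1 - θ)) * w m := by ring

end Summit.AnomalousDissipation.SoloBlind.NeumannIterate
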